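import Mathlib.Analysis.Calculus.Deriv.Shift
import Mathlib.Analysis.Calculus.Deriv.Mul
import Mathlib.Analysis.Calculus.Deriv.Pow
import Mathlib.Analysis.Normed.Operator.BoundedLinearMaps
import HarnessLib

/-!
# Gluing and corner rounding of curves subject to cone conditions (normed-space part)

This file contains the chart-free analysis behind the transitivity of the causal future `J⁺`
for the everywhere-differentiable causal curves of `Literature.Geometry.Lorentzian.Causality`
(`Literature.Geometry.Lorentzian.CausalFutureProofs`): in a real normed space `F` we are given a
field of continuous bilinear forms `G : F → F →L[ℝ] F →L[ℝ] ℝ` (the metric in a chart) and a map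
`T : F → F` (the time orientation in the chart); a pair `(x, v)` is *future causal* if
`G_x(v, v) ≤ 0`, `v ≠ 0`, `G_x(T_x, v) < 0`, and *future timelike* if `G_x(v, v) < 0`,
`G_x(T_x, v) < 0`.

* `glueAt t₀ f h` glues two curves at a parameter; `hasDerivAt_glueAt` is `C¹` gluing and
  `good_glueAt` propagates "derivative `u s` at `s` plus a property `Q` of position and velocity"
  through gluings.
* `transCurve A w P η` is the parabolic arc `A + s w + (s²/2η)(P - w)`, `s ∈ [0, η]`, bending the
  (possibly null) direction `w` into the timelike direction `P`; `transCurve_estimate` shows that for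
  small `η` it is future causal, timelike for `s > 0`: the margin `G_A(w, P) < 0` gained linearly in
  `s/η` beats the drift of the cones, which is `O(‖x - A‖)` because `G` is *differentiable at `A`*
  (a merely continuous `G` would not do).
* `bridgeCurve A P D ℓ` is a cubic arc with velocity `P` at both ends whose velocities sweep the
  segment `[P, D]`; `timelike_tube` gives a neighbourhood of `x₀` and of the ray through a future
  timelike `D` consisting of future timelike pairs.
* `corner_rounding_coord`: two good (future causal) coordinate curves meeting at `x₀` with
  non-proportional velocities `v̂₁, v̂₂` (so that `D = v̂₁ + v̂₂` is future timelike) are joined,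
  for every small `ε`, by transition (at `c₁(-ε)`) – bridge – reversed transition (at `c₂(ε)`) into
  a single good curve; the reversed transition is the transition for the data `(-T, -w₂, -P)` run
  backwards (`rev_good`). No finite-dimensionality and no uniform cone constants are used: every
  estimate is made at a single point with constants depending on the data there.

This is elementary calculus in the service of O'Neill 1983, Ch. 14, p. 402 (transitivity of `<`),
whose piecewise smooth causal curves need no rounding; compare Ch. 10, Lemma 10.45–Prop. 10.46 for
the deformation of causal curves into timelike ones. Nothing here depends on manifolds.

## References

* B. O'Neill, *Semi-Riemannian geometry with applications to relativity*, Academic Press 1983,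
  Ch. 10 (Lemma 45, Prop. 46), Ch. 14, p. 402.
-/

-- `maxSynthPendingDepth 2`: instance search on the nested operator space `F →L[ℝ] F →L[ℝ] ℝ`
-- (its normed-group structure) needs one more pending level than the default.
set_option maxSynthPendingDepth 2

noncomputable section

open Set Filter Function Asymptotics
open scoped Topology

namespace Literature.Geometry.Lorentzian

namespace CausalCurveGluing

variable {F : Type*} [NormedAddCommGroup F] [NormedSpace ℝ F]

/-! ### Gluing curves at a parameter -/

/-- Glue two curves at the parameter `t₀`: `f` up to and including `t₀`, then `h`. [folklore] -/
def glueAt {X : Type*} (t₀ : ℝ) (f h : ℝ → X) : ℝ → X := fun s ↦ if s ≤ t₀ then f s else h s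

/-- The glued curve before the junction. [folklore] -/
lemma glueAt_of_le {X : Type*} {t₀ : ℝ} {f h : ℝ → X} {s : ℝ} (hs : s ≤ t₀) :
    glueAt t₀ f h s = f s := if_pos hs

/-- The glued curve after the junction. [folklore] -/
lemma glueAt_of_lt {X : Type*} {t₀ : ℝ} {f h : ℝ → X} {s : ℝ} (hs : t₀ < s) :
    glueAt t₀ f h s = h s := if_neg (not_le.mpr hs)

/-- Left of the junction the glued curve is eventually `f`. [folklore] -/
lemma glueAt_eventuallyEq_left {X : Type*} {t₀ : ℝ} (f h : ℝ → X) {s : ℝ} (hs : s < t₀) :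
    glueAt t₀ f h =ᶠ[𝓝 s] f :=
  (eventually_lt_nhds hs).mono fun _ hy ↦ glueAt_of_le hy.le

/-- Right of the junction the glued curve is eventually `h`. [folklore] -/
lemma glueAt_eventuallyEq_right {X : Type*} {t₀ : ℝ} (f h : ℝ → X) {s : ℝ} (hs : t₀ < s) :
    glueAt t₀ f h =ᶠ[𝓝 s] h :=
  (eventually_gt_nhds hs).mono fun _ hy ↦ glueAt_of_lt hy

/-- Differentiability of a glued curve away from the junction (left). [folklore] -/
lemma hasDerivAt_glueAt_left {t₀ : ℝ} {f h : ℝ → F} {s : ℝ} {u : F} (hs : s < t₀)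
    (hf : HasDerivAt f u s) : HasDerivAt (glueAt t₀ f h) u s :=
  hf.congr_of_eventuallyEq (glueAt_eventuallyEq_left f h hs)

/-- Differentiability of a glued curve away from the junction (right). [folklore] -/
lemma hasDerivAt_glueAt_right {t₀ : ℝ} {f h : ℝ → F} {s : ℝ} {u : F} (hs : t₀ < s)
    (hh : HasDerivAt h u s) : HasDerivAt (glueAt t₀ f h) u s :=
  hh.congr_of_eventuallyEq (glueAt_eventuallyEq_right f h hs)

/-- **`C¹` gluing**: if `f` and `h` agree at `t₀` together with their derivatives, the glued curve
is differentiable at the junction. [folklore] -/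
lemma hasDerivAt_glueAt {t₀ : ℝ} {f h : ℝ → F} {u : F} (hf : HasDerivAt f u t₀)
    (hh : HasDerivAt h u t₀) (heq : f t₀ = h t₀) : HasDerivAt (glueAt t₀ f h) u t₀ := by
  have h1 : HasDerivWithinAt (glueAt t₀ f h) u (Iic t₀) t₀ :=
    hf.hasDerivWithinAt.congr (fun x hx ↦ glueAt_of_le hx) (glueAt_of_le le_rfl)
  have h2 : HasDerivWithinAt (glueAt t₀ f h) u (Ici t₀) t₀ := by
    refine hh.hasDerivWithinAt.congr (fun x hx ↦ ?_) (by rw [glueAt_of_le le_rfl, heq])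
    rcases eq_or_lt_of_le (mem_Ici.mp hx) with h' | h'
    · rw [← h', glueAt_of_le le_rfl, heq]
    · exact glueAt_of_lt h'
  have := h1.union h2
  rwa [Iic_union_Ici, hasDerivWithinAt_univ] at this

/-- **Gluing preserves "goodness"**: if `f` is good on `[a, t₀]` and `h` on `[t₀, b]` (pointwise
derivative `u` plus a property `Q` of position and velocity), and positions and velocities match
at `t₀`, then the glued curve is good on `[a, b]` with the glued velocity field. [folklore] -/
lemma good_glueAt {Q : F → F → Prop} {f h : ℝ → F} {uf uh : ℝ → F} {a t₀ b : ℝ}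
    (hf : ∀ s ∈ Icc a t₀, HasDerivAt f (uf s) s ∧ Q (f s) (uf s))
    (hh : ∀ s ∈ Icc t₀ b, HasDerivAt h (uh s) s ∧ Q (h s) (uh s))
    (heq : f t₀ = h t₀) (hu : uf t₀ = uh t₀) :
    ∀ s ∈ Icc a b, HasDerivAt (glueAt t₀ f h) (glueAt t₀ uf uh s) s ∧
      Q (glueAt t₀ f h s) (glueAt t₀ uf uh s) := by
  intro s hs
  rcases lt_trichotomy s t₀ with hlt | heq' | hgt
  · obtain ⟨hd, hQ⟩ := hf s ⟨hs.1, hlt.le⟩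
    rw [glueAt_of_le hlt.le, glueAt_of_le hlt.le]
    exact ⟨hasDerivAt_glueAt_left hlt hd, hQ⟩
  · subst heq'
    obtain ⟨hd, hQ⟩ := hf s ⟨hs.1, le_rfl⟩
    obtain ⟨hd', -⟩ := hh s ⟨le_rfl, hs.2⟩
    rw [glueAt_of_le le_rfl, glueAt_of_le le_rfl]
    rw [← hu] at hd'
    exact ⟨hasDerivAt_glueAt hd hd' heq, hQ⟩
  · obtain ⟨hd, hQ⟩ := hh s ⟨hgt.le, hs.2⟩
    rw [glueAt_of_lt hgt, glueAt_of_lt hgt]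
    exact ⟨hasDerivAt_glueAt_right hgt hd, hQ⟩

/-! ### Local Lipschitz bound from differentiability -/

/-- A function differentiable at `A` is Lipschitz *at* `A`: `‖G x - G A‖ ≤ L ‖x - A‖` near `A`
(the `O`-bound in the definition of the Fréchet derivative). [folklore] -/
lemma exists_bound_of_differentiableAt {V : Type*} [NormedAddCommGroup V] [NormedSpace ℝ V]
    {G : F → V} {A : F} (hG : DifferentiableAt ℝ G A) :
    ∃ L : ℝ, 0 < L ∧ ∃ ρ : ℝ, 0 < ρ ∧ ∀ x, ‖x - A‖ < ρ → ‖G x - G A‖ ≤ L * ‖x - A‖ := by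
  obtain ⟨c, hc, hcO⟩ := hG.hasFDerivAt.isBigO_sub.exists_pos
  rw [isBigOWith_iff, Metric.eventually_nhds_iff] at hcO
  obtain ⟨ρ, hρ, h⟩ := hcO
  exact ⟨c, hc, ρ, hρ, fun x hx ↦ h (by rwa [dist_eq_norm])⟩

/-! ### The transition curve: bending a causal direction into a timelike one -/

/-- The transition curve `x(s) = A + s w + (s²/2η)(P - w)`. [folklore] -/
def transCurve (A w P : F) (η : ℝ) (s : ℝ) : F := A + s • w + (s ^ 2 / (2 * η)) • (P - w)

/-- Its velocity `u(s) = w + (s/η)(P - w)`. [folklore] -/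
def transVel (w P : F) (η : ℝ) (s : ℝ) : F := w + (s / η) • (P - w)

/-- The transition curve has velocity `transVel`. [folklore] -/
lemma hasDerivAt_transCurve (A w P : F) (η s : ℝ) :
    HasDerivAt (transCurve A w P η) (transVel w P η s) s := by
  have h1 : HasDerivAt (fun s : ℝ ↦ s • w) ((1 : ℝ) • w) s := (hasDerivAt_id s).smul_const w
  have h2 : HasDerivAt (fun s : ℝ ↦ (s ^ 2 / (2 * η)) • (P - w))
      ((↑(2 : ℕ) * s ^ (2 - 1) / (2 * η)) • (P - w)) s :=
    ((hasDerivAt_pow 2 s).div_const (2 * η)).smul_const (P - w)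
  have h : HasDerivAt (fun s : ℝ ↦ A + s • w + (s ^ 2 / (2 * η)) • (P - w))
      ((1 : ℝ) • w + (↑(2 : ℕ) * s ^ (2 - 1) / (2 * η)) • (P - w)) s := (h1.const_add A).add h2
  refine h.congr_deriv ?_
  rw [one_smul, transVel]
  congr 1
  rcases eq_or_ne η 0 with hη | hη
  · simp [hη]
  · congr 1
    simp only [Nat.cast_ofNat, Nat.add_one_sub_one, pow_one]
    field_simp

/-- The transition curve starts at `A`. [folklore] -/
@[simp] lemma transCurve_zero (A w P : F) (η : ℝ) : transCurve A w P η 0 = A := by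
  simp [transCurve]

/-- The transition starts with velocity `w`. [folklore] -/
@[simp] lemma transVel_zero (w P : F) (η : ℝ) : transVel w P η 0 = w := by simp [transVel]

/-- The transition curve ends at `A + (η/2)(w + P)`. [folklore] -/
lemma transCurve_self (A w P : F) {η : ℝ} (hη : η ≠ 0) :
    transCurve A w P η η = A + (η / 2) • (w + P) := by
  simp only [transCurve]
  have : η ^ 2 / (2 * η) = η / 2 := by field_simp
  rw [this, smul_sub, smul_add, add_assoc]
  congr 1
  module

/-- The transition ends with velocity `P`. [folklore] -/
lemma transVel_self (w P : F) {η : ℝ} (hη : η ≠ 0) : transVel w P η η = P := by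
  simp [transVel, div_self hη]

/-- The transition velocity as a convex combination of `w` and `P`. [folklore] -/
lemma transVel_eq (w P : F) (η s : ℝ) :
    transVel w P η s = (1 - s / η) • w + (s / η) • P := by
  simp only [transVel, smul_sub, sub_smul, one_smul]; abel

/-- Norm bound for the transition velocity. [folklore] -/
lemma norm_transVel_le (w P : F) {η s : ℝ} (hη : 0 < η) (hs0 : 0 ≤ s) (hs : s ≤ η) :
    ‖transVel w P η s‖ ≤ ‖w‖ + ‖P‖ := by
  have hr0 : 0 ≤ s / η := div_nonneg hs0 hη.le
  have hr1 : s / η ≤ 1 := (div_le_one hη).mpr hs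
  rw [transVel_eq]
  calc ‖(1 - s / η) • w + (s / η) • P‖ ≤ ‖(1 - s / η) • w‖ + ‖(s / η) • P‖ := norm_add_le _ _
    _ = (1 - s / η) * ‖w‖ + (s / η) * ‖P‖ := by
        rw [norm_smul, norm_smul, Real.norm_of_nonneg hr0, Real.norm_of_nonneg (by linarith)]
    _ ≤ 1 * ‖w‖ + 1 * ‖P‖ := by gcongr; linarith
    _ = ‖w‖ + ‖P‖ := by ring

/-- The transition curve stays within `2 s (‖w‖ + ‖P‖)` of `A`. [folklore] -/
lemma norm_transCurve_sub_le (A w P : F) {η s : ℝ} (hη : 0 < η) (hs0 : 0 ≤ s) (hs : s ≤ η) :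
    ‖transCurve A w P η s - A‖ ≤ 2 * s * (‖w‖ + ‖P‖) := by
  have hr1 : s / η ≤ 1 := (div_le_one hη).mpr hs
  have h1 : transCurve A w P η s - A = s • w + (s ^ 2 / (2 * η)) • (P - w) := by
    simp only [transCurve]; abel
  rw [h1]
  have h2 : s ^ 2 / (2 * η) = s * (s / η) / 2 := by field_simp
  calc ‖s • w + (s ^ 2 / (2 * η)) • (P - w)‖ ≤ ‖s • w‖ + ‖(s ^ 2 / (2 * η)) • (P - w)‖ :=
        norm_add_le _ _
    _ = s * ‖w‖ + s * (s / η) / 2 * ‖P - w‖ := by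
        rw [norm_smul, norm_smul, h2, Real.norm_of_nonneg hs0,
          Real.norm_of_nonneg (by positivity)]
    _ ≤ s * ‖w‖ + s * 1 / 2 * (‖P‖ + ‖w‖) := by gcongr; exact norm_sub_le _ _
    _ ≤ 2 * s * (‖w‖ + ‖P‖) := by nlinarith [norm_nonneg w, norm_nonneg P]

/-- **The transition estimate.** Let `G` be a field of bilinear forms which is Lipschitz at `A`
(`‖G x - G A‖ ≤ L‖x - A‖` on a ball), let `w` be `G_A`-causal (`G_A(w,w) ≤ 0`) and `P` be such
that `G_A(w,P) < 0`, `G_A(P,P) < 0`, and suppose the linear forms `G_x(T_x, ·)` are negative on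
`w` and `P` throughout the ball. Then for all small `η > 0` the transition curve
`x(s) = A + s w + (s²/2η)(P - w)`, `s ∈ [0, η]`, stays in the ball and its velocity
`u(s) = (1 - s/η) w + (s/η) P` satisfies `G_{x(s)}(u,u) ≤ 0` (`< 0` for `s > 0`), `u ≠ 0`,
`G_{x(s)}(T_{x(s)}, u) < 0`. This is the local "push into the timecone" used to round corners
of causal curves (compare O'Neill 1983, Ch. 10, Lemma 10.45: deforming a causal curve so that
`⟨V', α'⟩ < 0` makes it timelike). [folklore] -/
theorem transCurve_estimate {G : F → F →L[ℝ] F →L[ℝ] ℝ} {T : F → F} {A w P : F} {L ρ : ℝ}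
    (hL0 : 0 < L) (hρ : 0 < ρ) (hL : ∀ x, ‖x - A‖ < ρ → ‖G x - G A‖ ≤ L * ‖x - A‖)
    (hTw : ∀ x, ‖x - A‖ < ρ → G x (T x) w < 0) (hTP : ∀ x, ‖x - A‖ < ρ → G x (T x) P < 0)
    (hsym : G A P w = G A w P) (hww : G A w w ≤ 0) (hwP : G A w P < 0) (hPP : G A P P < 0) :
    ∃ η₀ : ℝ, 0 < η₀ ∧ ∀ η : ℝ, 0 < η → η ≤ η₀ → ∀ s ∈ Icc (0 : ℝ) η,
      ‖transCurve A w P η s - A‖ < ρ ∧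
      G (transCurve A w P η s) (transVel w P η s) (transVel w P η s) ≤ 0 ∧
      (0 < s → G (transCurve A w P η s) (transVel w P η s) (transVel w P η s) < 0) ∧
      transVel w P η s ≠ 0 ∧
      G (transCurve A w P η s) (T (transCurve A w P η s)) (transVel w P η s) < 0 := by
  set C := ‖w‖ + ‖P‖ with hC
  set μ := min (-G A w P) (-G A P P) with hμ
  have hμ0 : 0 < μ := lt_min (by linarith) (by linarith)
  have hC0 : 0 ≤ C := by positivity
  refine ⟨min (ρ / (4 * C + 1)) (μ / (4 * L * C ^ 3 + 1)), lt_min (by positivity) (by positivity),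
    fun η hη hηle s hs ↦ ?_⟩
  obtain ⟨hs0, hsη⟩ := hs
  have hη1 : η ≤ ρ / (4 * C + 1) := hηle.trans (min_le_left _ _)
  have hη2 : η ≤ μ / (4 * L * C ^ 3 + 1) := hηle.trans (min_le_right _ _)
  set x := transCurve A w P η s with hx
  set u := transVel w P η s with hu
  set r := s / η with hr
  have hr0 : 0 ≤ r := div_nonneg hs0 hη.le
  have hr1 : r ≤ 1 := (div_le_one hη).mpr hsη
  -- the curve stays in the ball
  have hxA : ‖x - A‖ ≤ 2 * s * C := norm_transCurve_sub_le A w P hη hs0 hsη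
  have hxA' : ‖x - A‖ ≤ 2 * η * C := hxA.trans (by gcongr)
  have hball : ‖x - A‖ < ρ := by
    have h1 : η * (4 * C + 1) ≤ ρ := (le_div_iff₀ (by positivity)).mp hη1
    nlinarith [h1, hxA', hη, hC0]
  -- velocity as a convex combination
  have hueq : u = (1 - r) • w + r • P := transVel_eq w P η s
  have hnu : ‖u‖ ≤ C := norm_transVel_le w P hη hs0 hsη
  have hsr : s = r * η := by rw [hr]; field_simp
  clear_value x u r
  -- the value at `A`
  have hGA : G A u u ≤ -(μ * r) := by
    have hexp : G A u u = (1 - r) ^ 2 * G A w w + 2 * (r * (1 - r)) * G A w P + r ^ 2 * G A P P := by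
      rw [hueq]
      simp only [map_add, map_smul, add_apply, smul_apply, smul_eq_mul, hsym]
      ring
    rw [hexp]
    have hm1 : G A w P ≤ -μ := by have := min_le_left (-G A w P) (-G A P P); linarith
    have hm2 : G A P P ≤ -μ := by have := min_le_right (-G A w P) (-G A P P); linarith
    have hc2 : 0 ≤ 2 * (r * (1 - r)) := by nlinarith
    have k1 : (1 - r) ^ 2 * G A w w ≤ 0 := mul_nonpos_of_nonneg_of_nonpos (sq_nonneg _) hww
    have k2 : 2 * (r * (1 - r)) * G A w P ≤ 2 * (r * (1 - r)) * (-μ) :=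
      mul_le_mul_of_nonneg_left hm1 hc2
    have k3 : r ^ 2 * G A P P ≤ r ^ 2 * (-μ) := mul_le_mul_of_nonneg_left hm2 (sq_nonneg r)
    have k4 : 0 ≤ μ * r * (1 - r) := mul_nonneg (mul_nonneg hμ0.le hr0) (sub_nonneg.mpr hr1)
    nlinarith [k1, k2, k3, k4]
  -- the drift
  have hdrift : |G x u u - G A u u| ≤ 2 * L * η * C ^ 3 * r := by
    have h1 : G x u u - G A u u = (G x - G A) u u := by simp [sub_apply]
    rw [h1]
    calc |(G x - G A) u u| = ‖(G x - G A) u u‖ := (Real.norm_eq_abs _).symm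
      _ ≤ ‖G x - G A‖ * ‖u‖ * ‖u‖ := ContinuousLinearMap.le_opNorm₂ _ _ _
      _ ≤ (L * ‖x - A‖) * C * C := by gcongr; exact hL x hball
      _ ≤ (L * (2 * s * C)) * C * C := by gcongr
      _ = 2 * L * η * C ^ 3 * r := by rw [hsr]; ring
  have hkey : 2 * L * η * C ^ 3 ≤ μ / 2 := by
    have h1 : 2 * L * η * C ^ 3 ≤ 2 * L * (μ / (4 * L * C ^ 3 + 1)) * C ^ 3 := by gcongr
    have h2 : 2 * L * (μ / (4 * L * C ^ 3 + 1)) * C ^ 3 = μ * (2 * L * C ^ 3 / (4 * L * C ^ 3 + 1)) := by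
      ring
    have h3 : 2 * L * C ^ 3 / (4 * L * C ^ 3 + 1) ≤ 1 / 2 := by
      rw [div_le_iff₀ (by positivity)]; nlinarith [mul_nonneg hL0.le (pow_nonneg hC0 3)]
    calc 2 * L * η * C ^ 3 ≤ μ * (2 * L * C ^ 3 / (4 * L * C ^ 3 + 1)) := h1.trans h2.le
      _ ≤ μ * (1 / 2) := by gcongr
      _ = μ / 2 := by ring
  have hGx : G x u u ≤ -(μ * r / 2) := by
    have := (abs_le.mp hdrift).2
    nlinarith [mul_le_mul_of_nonneg_right hkey hr0]
  -- future-directedness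
  have hfut : G x (T x) u < 0 := by
    have hexp : G x (T x) u = (1 - r) * G x (T x) w + r * G x (T x) P := by
      rw [hueq, map_add, map_smul, map_smul, smul_eq_mul, smul_eq_mul]
    rw [hexp]
    have h1 := hTw x hball
    have h2 := hTP x hball
    rcases eq_or_lt_of_le hr0 with h0 | h0
    · rw [← h0]; linarith
    · have k1 : (1 - r) * G x (T x) w ≤ 0 :=
        mul_nonpos_of_nonneg_of_nonpos (sub_nonneg.mpr hr1) h1.le
      have k2 : r * G x (T x) P < 0 := mul_neg_of_pos_of_neg h0 h2
      linarith
  have hc1 : G x u u ≤ 0 := by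
    have : 0 ≤ μ * r := mul_nonneg hμ0.le hr0
    linarith
  have hc2 : 0 < s → G x u u < 0 := fun hspos ↦ by
    have hrpos : 0 < r := by
      rcases eq_or_lt_of_le hr0 with h0 | h0
      · exfalso; rw [← h0, zero_mul] at hsr; exact hspos.ne' hsr
      · exact h0
    have : 0 < μ * r := mul_pos hμ0 hrpos
    linarith
  have hc3 : u ≠ 0 := fun h0 ↦ by
    rw [h0, map_zero] at hfut; exact lt_irrefl 0 hfut
  exact ⟨hball, hc1, hc2, hc3, hfut⟩

/-! ### The bridge curve: a timelike arc with prescribed end velocities -/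

/-- The bridge curve `x(s) = A + s P + (2s²/ℓ - (4/3)s³/ℓ²)(D - P)`: it starts at `A` with
velocity `P`, ends at parameter `ℓ` at `A + ℓ(P/3 + 2D/3)` with velocity `P`, and its velocity
`P + b (D - P)`, `b = 4(s/ℓ)(1 - s/ℓ) ∈ [0, 1]`, sweeps the segment from `P` to `D` and back. [folklore] -/
def bridgeCurve (A P D : F) (ℓ : ℝ) (s : ℝ) : F :=
  A + s • P + (2 * s ^ 2 / ℓ - 4 / 3 * s ^ 3 / ℓ ^ 2) • (D - P)

/-- The velocity of the bridge curve. [folklore] -/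
def bridgeVel (P D : F) (ℓ : ℝ) (s : ℝ) : F := P + (4 * s / ℓ - 4 * s ^ 2 / ℓ ^ 2) • (D - P)

/-- The bridge curve has velocity `bridgeVel`. [folklore] -/
lemma hasDerivAt_bridgeCurve (A P D : F) (ℓ s : ℝ) :
    HasDerivAt (bridgeCurve A P D ℓ) (bridgeVel P D ℓ s) s := by
  have h1 : HasDerivAt (fun s : ℝ ↦ s • P) ((1 : ℝ) • P) s := (hasDerivAt_id s).smul_const P
  have h2 : HasDerivAt (fun s : ℝ ↦ 2 * s ^ 2 / ℓ - 4 / 3 * s ^ 3 / ℓ ^ 2)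
      (2 * (↑(2 : ℕ) * s ^ (2 - 1)) / ℓ - 4 / 3 * (↑(3 : ℕ) * s ^ (3 - 1)) / ℓ ^ 2) s :=
    (((hasDerivAt_pow 2 s).const_mul 2).div_const ℓ).sub
      (((hasDerivAt_pow 3 s).const_mul (4 / 3)).div_const (ℓ ^ 2))
  have h : HasDerivAt (fun s : ℝ ↦ A + s • P + (2 * s ^ 2 / ℓ - 4 / 3 * s ^ 3 / ℓ ^ 2) • (D - P))
      ((1 : ℝ) • P + (2 * (↑(2 : ℕ) * s ^ (2 - 1)) / ℓ - 4 / 3 * (↑(3 : ℕ) * s ^ (3 - 1)) / ℓ ^ 2)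
        • (D - P)) s := (h1.const_add A).add (h2.smul_const (D - P))
  refine h.congr_deriv ?_
  rw [one_smul, bridgeVel]
  congr 1
  congr 1
  simp only [Nat.cast_ofNat, Nat.add_one_sub_one, pow_one]
  ring

/-- The bridge starts at `A`. [folklore] -/
@[simp] lemma bridgeCurve_zero (A P D : F) (ℓ : ℝ) : bridgeCurve A P D ℓ 0 = A := by
  simp [bridgeCurve]

/-- The bridge starts with velocity `P`. [folklore] -/
@[simp] lemma bridgeVel_zero (P D : F) (ℓ : ℝ) : bridgeVel P D ℓ 0 = P := by simp [bridgeVel]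

/-- The bridge ends with velocity `P`. [folklore] -/
lemma bridgeVel_self (P D : F) {ℓ : ℝ} (hℓ : ℓ ≠ 0) : bridgeVel P D ℓ ℓ = P := by
  simp only [bridgeVel]
  have : 4 * ℓ / ℓ - 4 * ℓ ^ 2 / ℓ ^ 2 = 0 := by field_simp; ring
  rw [this, zero_smul, add_zero]

/-- The endpoint of the bridge. [folklore] -/
lemma bridgeCurve_self (A P D : F) {ℓ : ℝ} (hℓ : ℓ ≠ 0) :
    bridgeCurve A P D ℓ ℓ = A + ℓ • ((1 / 3 : ℝ) • P + (2 / 3 : ℝ) • D) := by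
  simp only [bridgeCurve]
  have : 2 * ℓ ^ 2 / ℓ - 4 / 3 * ℓ ^ 3 / ℓ ^ 2 = 2 / 3 * ℓ := by field_simp; ring
  rw [this, smul_sub, smul_add, smul_smul, smul_smul, add_assoc]
  congr 1
  module

/-- With `D = (3/(2ℓ))(B - A) - P/2` the bridge curve ends at `B`. [folklore] -/
lemma bridgeCurve_self_eq (A B P : F) {ℓ : ℝ} (hℓ : ℓ ≠ 0) :
    bridgeCurve A P ((3 / (2 * ℓ)) • (B - A) - (1 / 2 : ℝ) • P) ℓ ℓ = B := by
  simp only [bridgeCurve]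
  have h0 : 2 * ℓ ^ 2 / ℓ - 4 / 3 * ℓ ^ 3 / ℓ ^ 2 = 2 / 3 * ℓ := by field_simp; ring
  rw [h0]
  simp only [smul_sub, smul_smul]
  have h2 : 2 / 3 * ℓ * (3 / (2 * ℓ)) = 1 := by field_simp
  rw [h2, one_smul]
  module

/-- The bump coefficient of the bridge velocity. [folklore] -/
lemma bridgeVel_eq (P D : F) (ℓ s : ℝ) :
    bridgeVel P D ℓ s = (1 - (4 * s / ℓ - 4 * s ^ 2 / ℓ ^ 2)) • P +
      (4 * s / ℓ - 4 * s ^ 2 / ℓ ^ 2) • D := by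
  simp only [bridgeVel, smul_sub, sub_smul, one_smul]; abel

/-- The bump coefficient lies in `[0, 1]` on `[0, ℓ]`. [folklore] -/
lemma bridge_coeff_mem {ℓ s : ℝ} (hℓ : 0 < ℓ) (hs0 : 0 ≤ s) (hs : s ≤ ℓ) :
    4 * s / ℓ - 4 * s ^ 2 / ℓ ^ 2 ∈ Icc (0 : ℝ) 1 := by
  have hr0 : 0 ≤ s / ℓ := div_nonneg hs0 hℓ.le
  have hr1 : s / ℓ ≤ 1 := (div_le_one hℓ).mpr hs
  have heq : 4 * s / ℓ - 4 * s ^ 2 / ℓ ^ 2 = 4 * (s / ℓ) * (1 - s / ℓ) := by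
    field_simp
  rw [heq]
  constructor
  · have := mul_nonneg hr0 (sub_nonneg.mpr hr1); nlinarith
  · nlinarith [sq_nonneg (s / ℓ - 1 / 2)]

/-- The bridge stays within `s (‖P‖ + 2‖D - P‖)` of `A`. [folklore] -/
lemma norm_bridgeCurve_sub_le (A P D : F) {ℓ s : ℝ} (hℓ : 0 < ℓ) (hs0 : 0 ≤ s) (hs : s ≤ ℓ) :
    ‖bridgeCurve A P D ℓ s - A‖ ≤ s * (‖P‖ + 2 * ‖D - P‖) := by
  have hr0 : 0 ≤ s / ℓ := div_nonneg hs0 hℓ.le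
  have hr1 : s / ℓ ≤ 1 := (div_le_one hℓ).mpr hs
  have h1 : bridgeCurve A P D ℓ s - A = s • P + (2 * s ^ 2 / ℓ - 4 / 3 * s ^ 3 / ℓ ^ 2) • (D - P) := by
    simp only [bridgeCurve]; abel
  have hc : 2 * s ^ 2 / ℓ - 4 / 3 * s ^ 3 / ℓ ^ 2 = s * ((s / ℓ) * (2 - 4 / 3 * (s / ℓ))) := by
    field_simp
  have hc0 : 0 ≤ (s / ℓ) * (2 - 4 / 3 * (s / ℓ)) := mul_nonneg hr0 (by linarith)
  have hc1 : (s / ℓ) * (2 - 4 / 3 * (s / ℓ)) ≤ 2 := by nlinarith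
  rw [h1]
  calc ‖s • P + (2 * s ^ 2 / ℓ - 4 / 3 * s ^ 3 / ℓ ^ 2) • (D - P)‖
        ≤ ‖s • P‖ + ‖(2 * s ^ 2 / ℓ - 4 / 3 * s ^ 3 / ℓ ^ 2) • (D - P)‖ := norm_add_le _ _
    _ = s * ‖P‖ + s * ((s / ℓ) * (2 - 4 / 3 * (s / ℓ))) * ‖D - P‖ := by
        rw [norm_smul, norm_smul, hc, Real.norm_of_nonneg hs0,
          Real.norm_of_nonneg (mul_nonneg hs0 hc0)]
    _ ≤ s * ‖P‖ + s * 2 * ‖D - P‖ := by gcongr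
    _ = s * (‖P‖ + 2 * ‖D - P‖) := by ring

/-! ### A tube of timelike directions around a timelike vector -/

/-- **Timelike tube.** If `D` is future timelike at `x₀` for a field of bilinear forms `G` and
linear forms `G_x(T_x, ·)` both continuous at `x₀`, then all vectors `μ D + e` with
`μ ∈ [1/2, 2]` and `e` small are future timelike at all points near `x₀` (openness of the timecone,
uniformly in the base point). [folklore] -/
theorem timelike_tube {G : F → F →L[ℝ] F →L[ℝ] ℝ} {T : F → F} {x₀ D : F}
    (hG : ContinuousAt G x₀) (hGT : ContinuousAt (fun x ↦ G x (T x)) x₀)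
    (hD : G x₀ D D < 0) (hTD : G x₀ (T x₀) D < 0) :
    ∃ ρ : ℝ, 0 < ρ ∧ ∃ δ : ℝ, 0 < δ ∧ ∀ x, ‖x - x₀‖ < ρ → ∀ μ ∈ Icc (1 / 2 : ℝ) 2, ∀ e : F,
      ‖e‖ ≤ δ → G x (μ • D + e) (μ • D + e) < 0 ∧ G x (T x) (μ • D + e) < 0 := by
  set m := -G x₀ D D with hm
  set m' := -G x₀ (T x₀) D with hm'
  have hm0 : 0 < m := by rw [hm]; linarith
  have hm'0 : 0 < m' := by rw [hm']; linarith
  set K := ‖G x₀‖ + 1 with hK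
  set K' := ‖G x₀ (T x₀)‖ + 1 with hK'
  have hK0 : 0 < K := by positivity
  have hK'0 : 0 < K' := by positivity
  set nD := ‖D‖ with hnD
  have hnD0 : 0 ≤ nD := norm_nonneg D
  -- continuity radii
  set ε₁ := min 1 (m / (32 * (nD ^ 2 + 1))) with hε₁
  set ε₂ := min 1 (m' / (2 * (nD + 1))) with hε₂
  have hε₁0 : 0 < ε₁ := lt_min one_pos (by positivity)
  have hε₂0 : 0 < ε₂ := lt_min one_pos (by positivity)
  rw [Metric.continuousAt_iff] at hG hGT
  obtain ⟨ρ₁, hρ₁, h₁⟩ := hG ε₁ hε₁0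
  obtain ⟨ρ₂, hρ₂, h₂⟩ := hGT ε₂ hε₂0
  set δ := min 1 (min (m / (64 * K * (nD + 1))) (m' / (8 * K'))) with hδ
  have hδ0 : 0 < δ := lt_min one_pos (lt_min (by positivity) (by positivity))
  refine ⟨min ρ₁ ρ₂, lt_min hρ₁ hρ₂, δ, hδ0, fun x hx μ hμ e he ↦ ?_⟩
  obtain ⟨hμ1, hμ2⟩ := hμ
  have hx1 : dist x x₀ < ρ₁ := by rw [dist_eq_norm]; exact hx.trans_le (min_le_left _ _)
  have hx2 : dist x x₀ < ρ₂ := by rw [dist_eq_norm]; exact hx.trans_le (min_le_right _ _)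
  have hG1 : ‖G x - G x₀‖ < ε₁ := by rw [← dist_eq_norm]; exact h₁ hx1
  have hG2 : ‖G x (T x) - G x₀ (T x₀)‖ < ε₂ := by rw [← dist_eq_norm]; exact h₂ hx2
  have hε₁1 : ε₁ ≤ 1 := min_le_left _ _
  have hε₁2 : ε₁ ≤ m / (32 * (nD ^ 2 + 1)) := min_le_right _ _
  have hε₂2 : ε₂ ≤ m' / (2 * (nD + 1)) := min_le_right _ _
  have hδ1 : δ ≤ 1 := min_le_left _ _
  have hδ2 : δ ≤ m / (64 * K * (nD + 1)) := (min_le_right _ _).trans (min_le_left _ _)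
  have hδ3 : δ ≤ m' / (8 * K') := (min_le_right _ _).trans (min_le_right _ _)
  have hε₂1 : ε₂ ≤ 1 := min_le_left _ _
  have hGx : ‖G x‖ ≤ K := by
    have := norm_le_insert' (G x) (G x₀); rw [hK]; linarith [hG1.le]
  have hGTx : ‖G x (T x)‖ ≤ K' := by
    have := norm_le_insert' (G x (T x)) (G x₀ (T x₀)); rw [hK']; linarith [hG2.le]
  have he0 : 0 ≤ ‖e‖ := norm_nonneg e
  clear_value m m' K K' nD ε₁ ε₂ δ
  -- numeric consequences of the choice of radii
  have b1 : ε₁ * nD ^ 2 ≤ m / 32 := by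
    have h := (le_div_iff₀ (by positivity : (0:ℝ) < 32 * (nD ^ 2 + 1))).mp hε₁2
    have h' : 0 ≤ ε₁ := hε₁0.le
    have hx : ε₁ * (32 * (nD ^ 2 + 1)) = 32 * (ε₁ * nD ^ 2) + 32 * ε₁ := by ring
    linarith only [h, h', hx]
  have b2 : K * nD * δ ≤ m / 64 := by
    have h := (le_div_iff₀ (by positivity : (0:ℝ) < 64 * K * (nD + 1))).mp hδ2
    have h' : 0 ≤ K * δ := mul_nonneg hK0.le hδ0.le
    have hx : δ * (64 * K * (nD + 1)) = 64 * (K * nD * δ) + 64 * (K * δ) := by ring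
    linarith only [h, h', hx]
  have b3 : K * δ ≤ m / 64 := by
    have h := (le_div_iff₀ (by positivity : (0:ℝ) < 64 * K * (nD + 1))).mp hδ2
    have h' : 0 ≤ K * nD * δ := mul_nonneg (mul_nonneg hK0.le hnD0) hδ0.le
    have hx : δ * (64 * K * (nD + 1)) = 64 * (K * nD * δ) + 64 * (K * δ) := by ring
    linarith only [h, h', hx]
  have b4 : ε₂ * nD ≤ m' / 2 := by
    have h := (le_div_iff₀ (by positivity : (0:ℝ) < 2 * (nD + 1))).mp hε₂2
    have h' : 0 ≤ ε₂ := hε₂0.le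
    have hx : ε₂ * (2 * (nD + 1)) = 2 * (ε₂ * nD) + 2 * ε₂ := by ring
    linarith only [h, h', hx]
  have b5 : K' * δ ≤ m' / 8 := by
    have h := (le_div_iff₀ (by positivity : (0:ℝ) < 8 * K')).mp hδ3
    have hx : δ * (8 * K') = 8 * (K' * δ) := by ring
    linarith only [h, hx]
  constructor
  · -- timelike
    have hexp : G x (μ • D + e) (μ • D + e) =
        μ ^ 2 * G x D D + μ * (G x D e + G x e D) + G x e e := by
      simp only [map_add, map_smul, add_apply, smul_apply, smul_eq_mul]; ring
    have hDD : G x D D ≤ -(31 * m / 32) := by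
      have h1 : G x D D - G x₀ D D = (G x - G x₀) D D := by simp [sub_apply]
      have h2 : |(G x - G x₀) D D| ≤ ‖G x - G x₀‖ * ‖D‖ * ‖D‖ := by
        rw [← Real.norm_eq_abs]; exact ContinuousLinearMap.le_opNorm₂ _ _ _
      have h3 := (abs_le.mp h2).2
      rw [← hnD, ← h1] at h3
      have h4 : ‖G x - G x₀‖ * nD * nD ≤ ε₁ * nD * nD := by gcongr
      have h5 : ε₁ * nD * nD = ε₁ * nD ^ 2 := by ring
      linarith
    have hDe : G x D e ≤ K * nD * δ := by
      calc G x D e ≤ |G x D e| := le_abs_self _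
        _ = ‖G x D e‖ := (Real.norm_eq_abs _).symm
        _ ≤ ‖G x‖ * ‖D‖ * ‖e‖ := ContinuousLinearMap.le_opNorm₂ _ _ _
        _ ≤ K * nD * δ := by rw [← hnD]; gcongr
    have heD : G x e D ≤ K * nD * δ := by
      calc G x e D ≤ |G x e D| := le_abs_self _
        _ = ‖G x e D‖ := (Real.norm_eq_abs _).symm
        _ ≤ ‖G x‖ * ‖e‖ * ‖D‖ := ContinuousLinearMap.le_opNorm₂ _ _ _
        _ ≤ K * δ * nD := by rw [← hnD]; gcongr
        _ = K * nD * δ := by ring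
    have hee : G x e e ≤ K * δ := by
      calc G x e e ≤ |G x e e| := le_abs_self _
        _ = ‖G x e e‖ := (Real.norm_eq_abs _).symm
        _ ≤ ‖G x‖ * ‖e‖ * ‖e‖ := ContinuousLinearMap.le_opNorm₂ _ _ _
        _ ≤ K * δ * 1 := by gcongr; exact he.trans hδ1
        _ = K * δ := mul_one _
    rw [hexp]
    have hμ0 : 0 ≤ μ := by linarith
    have hμsq : 1 / 4 ≤ μ ^ 2 := by
      have h1 : 1 / 2 * μ ≤ μ * μ := mul_le_mul_of_nonneg_right hμ1 hμ0
      have h2 : μ ^ 2 = μ * μ := sq μ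
      linarith only [h1, h2, hμ1]
    have k1 : μ ^ 2 * G x D D ≤ (1 / 4) * (-(31 * m / 32)) :=
      (mul_le_mul_of_nonneg_left hDD (sq_nonneg μ)).trans
        (mul_le_mul_of_nonpos_right hμsq (by linarith))
    have k2 : μ * (G x D e + G x e D) ≤ 2 * (2 * (m / 64)) := by
      have h5 : G x D e + G x e D ≤ 2 * (m / 64) := by linarith
      exact (mul_le_mul_of_nonneg_left h5 hμ0).trans
        (mul_le_mul_of_nonneg_right hμ2 (by linarith))
    have k3 : G x e e ≤ m / 64 := hee.trans b3
    linarith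
  · -- future
    have hexp : G x (T x) (μ • D + e) = μ * G x (T x) D + G x (T x) e := by
      simp only [map_add, map_smul, smul_eq_mul]
    have hTD' : G x (T x) D ≤ -(m' / 2) := by
      have h1 : G x (T x) D - G x₀ (T x₀) D = (G x (T x) - G x₀ (T x₀)) D := by simp [sub_apply]
      have h2 : |(G x (T x) - G x₀ (T x₀)) D| ≤ ‖G x (T x) - G x₀ (T x₀)‖ * ‖D‖ := by
        rw [← Real.norm_eq_abs]; exact ContinuousLinearMap.le_opNorm _ _
      have h3 := (abs_le.mp h2).2
      rw [← hnD, ← h1] at h3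
      have h4 : ‖G x (T x) - G x₀ (T x₀)‖ * nD ≤ ε₂ * nD := by gcongr
      linarith
    have hTe : G x (T x) e ≤ m' / 8 := by
      calc G x (T x) e ≤ |G x (T x) e| := le_abs_self _
        _ = ‖G x (T x) e‖ := (Real.norm_eq_abs _).symm
        _ ≤ ‖G x (T x)‖ * ‖e‖ := ContinuousLinearMap.le_opNorm _ _
        _ ≤ K' * δ := by gcongr
        _ ≤ m' / 8 := b5
    rw [hexp]
    have k1 : μ * G x (T x) D ≤ (1 / 2) * (-(m' / 2)) :=
      (mul_le_mul_of_nonneg_left hTD' (by linarith)).trans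
        (mul_le_mul_of_nonpos_right hμ1 (by linarith))
    linarith

/-! ### Goodness of shifted and reversed pieces -/

/-- A first-order Taylor bound from `HasDerivAt`. [folklore] -/
lemma exists_taylor_bound {c : ℝ → F} {v : F} {t : ℝ} (hc : HasDerivAt c v t) {κ : ℝ}
    (hκ : 0 < κ) : ∃ δ : ℝ, 0 < δ ∧ ∀ s, |s - t| < δ → ‖c s - c t - (s - t) • v‖ ≤ κ * |s - t| := by
  have h := hc.isLittleO.def hκ
  rw [Metric.eventually_nhds_iff] at h
  obtain ⟨δ, hδ, h⟩ := h
  refine ⟨δ, hδ, fun s hs ↦ ?_⟩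
  have := h (y := s) (by rwa [Real.dist_eq])
  simpa [Real.norm_eq_abs] using this

/-- **Reversing a transition.** From the transition estimate for the time-reversed data
(`-T`), the reversed curve `s ↦ x (s₄ - s)` with velocity `-u (s₄ - s)` satisfies the
future-directed causality conditions for `T`. [folklore] -/
lemma rev_good {G : F → F →L[ℝ] F →L[ℝ] ℝ} {T : F → F} {x u : ℝ → F} {x₀ : F} {R η s₄ : ℝ}
    (h : ∀ s ∈ Icc (0 : ℝ) η, HasDerivAt x (u s) s ∧ ‖x s - x₀‖ < R ∧
      (G (x s) (u s) (u s) ≤ 0 ∧ u s ≠ 0) ∧ G (x s) (-T (x s)) (u s) < 0) :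
    ∀ s ∈ Icc (s₄ - η) s₄, HasDerivAt (fun s ↦ x (s₄ - s)) (-u (s₄ - s)) s ∧
      ‖x (s₄ - s) - x₀‖ < R ∧ (G (x (s₄ - s)) (-u (s₄ - s)) (-u (s₄ - s)) ≤ 0 ∧ -u (s₄ - s) ≠ 0) ∧
      G (x (s₄ - s)) (T (x (s₄ - s))) (-u (s₄ - s)) < 0 := by
  intro s hs
  obtain ⟨hd, hball, ⟨hc, hne⟩, hfut⟩ := h (s₄ - s) ⟨by linarith [hs.2], by linarith [hs.1]⟩
  refine ⟨hd.comp_const_sub s₄ s, hball, ⟨?_, neg_ne_zero.mpr hne⟩, ?_⟩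
  · simpa using hc
  · have : G (x (s₄ - s)) (T (x (s₄ - s))) (-u (s₄ - s)) =
        G (x (s₄ - s)) (-T (x (s₄ - s))) (u (s₄ - s)) := by simp [map_neg]
    rw [this]; exact hfut

/-! ### Corner rounding in coordinates -/

/-- **Corner rounding in coordinates.** Let `G` be a field of symmetric bilinear forms on `F`,
differentiable on the ball `B(x₀, R)`, and `T : F → F` with `x ↦ G_x(T_x, ·)` continuous there;
assume the timecone inequality `G_x(v, w) < 0` for `v` future causal and `w` future timelike
(in the sense of the sign conditions) at points of the ball. Let `c₁` (on `[-δ₀, 0]`) and `c₂`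
(on `[0, δ₀]`) be good coordinate curves through `x₀ = c₁ 0 = c₂ 0` whose velocities `v̂₁ = u₁ 0`,
`v̂₂ = u₂ 0` at the corner have future *timelike* sum `D = v̂₁ + v̂₂`. Then for some `ε ∈ (0, ε₁]`
there is a good coordinate curve `ĉ` on `[-ε, s₄]` which coincides with `c₁` for `s ≤ -ε` and with
`s ↦ c₂ (s - s₄ + ε)` for `s ≥ s₄`: the corner has been replaced by transition–bridge–transition.
[folklore] -/
theorem corner_rounding_coord {G : F → F →L[ℝ] F →L[ℝ] ℝ} {T : F → F} {x₀ : F} {R δ₀ ε₁ : ℝ}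
    (hR : 0 < R) (hδ₀ : 0 < δ₀) (hε₁ : 0 < ε₁)
    (hGd : ∀ x, ‖x - x₀‖ < R → DifferentiableAt ℝ G x)
    (hTc : ∀ x, ‖x - x₀‖ < R → ContinuousAt (fun x ↦ G x (T x)) x)
    (hsymm : ∀ x, ‖x - x₀‖ < R → ∀ v w, G x v w = G x w v)
    (hcone : ∀ x, ‖x - x₀‖ < R → ∀ v w, G x v v ≤ 0 → v ≠ 0 → G x (T x) v < 0 →
      G x w w < 0 → G x (T x) w < 0 → G x v w < 0)
    {c₁ c₂ u₁ u₂ : ℝ → F}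
    (hc₁ : ∀ s ∈ Icc (-δ₀) 0, HasDerivAt c₁ (u₁ s) s ∧ ‖c₁ s - x₀‖ < R ∧
      (G (c₁ s) (u₁ s) (u₁ s) ≤ 0 ∧ u₁ s ≠ 0) ∧ G (c₁ s) (T (c₁ s)) (u₁ s) < 0)
    (hc₂ : ∀ s ∈ Icc 0 δ₀, HasDerivAt c₂ (u₂ s) s ∧ ‖c₂ s - x₀‖ < R ∧
      (G (c₂ s) (u₂ s) (u₂ s) ≤ 0 ∧ u₂ s ≠ 0) ∧ G (c₂ s) (T (c₂ s)) (u₂ s) < 0)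
    (h₁0 : c₁ 0 = x₀) (h₂0 : c₂ 0 = x₀)
    (hD : G x₀ (u₁ 0 + u₂ 0) (u₁ 0 + u₂ 0) < 0) (hTD : G x₀ (T x₀) (u₁ 0 + u₂ 0) < 0) :
    ∃ ε s₄ : ℝ, 0 < ε ∧ ε ≤ ε₁ ∧ ε ≤ δ₀ ∧ -ε < s₄ ∧ ∃ ĉ û : ℝ → F,
      (∀ s ∈ Icc (-ε) s₄, HasDerivAt ĉ (û s) s ∧ ‖ĉ s - x₀‖ < R ∧
        (G (ĉ s) (û s) (û s) ≤ 0 ∧ û s ≠ 0) ∧ G (ĉ s) (T (ĉ s)) (û s) < 0) ∧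
      (∀ s, s ≤ -ε → ĉ s = c₁ s) ∧ (∀ s, s₄ ≤ s → ĉ s = c₂ (s - s₄ + ε)) := by
  -- Step 0: data at the corner
  obtain ⟨D, hDdef⟩ : ∃ D : F, D = u₁ 0 + u₂ 0 := ⟨_, rfl⟩
  rw [← hDdef] at hD hTD
  obtain ⟨P, hPdef⟩ : ∃ P : F, P = (1 / 2 : ℝ) • D := ⟨_, rfl⟩
  have hx₀ : ‖x₀ - x₀‖ < R := by simpa using hR
  have hGc0 : ContinuousAt G x₀ := (hGd x₀ hx₀).continuousAt
  -- Step 1: the timelike tube around `D`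
  obtain ⟨ρt, hρt, δt, hδt, htube⟩ := timelike_tube hGc0 (hTc x₀ hx₀) hD hTD
  have hPtube : ∀ x, ‖x - x₀‖ < ρt → G x P P < 0 ∧ G x (T x) P < 0 := by
    intro x hx
    have := htube x hx (1 / 2) ⟨le_rfl, by norm_num⟩ 0 (by simpa using hδt.le)
    simpa [hPdef] using this
  -- Step 2: radii and Taylor bounds at the corner
  obtain ⟨r₀, hr₀0, hr₀R, hr₀t⟩ : ∃ r₀ : ℝ, 0 < r₀ ∧ r₀ ≤ R ∧ r₀ ≤ ρt :=
    ⟨min R ρt, lt_min hR hρt, min_le_left _ _, min_le_right _ _⟩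
  obtain ⟨κ, hκ⟩ : ∃ κ : ℝ, κ = δt / 6 := ⟨_, rfl⟩
  have hκ0 : 0 < κ := by rw [hκ]; positivity
  have hd₁ : HasDerivAt c₁ (u₁ 0) 0 := (hc₁ 0 ⟨by linarith, le_rfl⟩).1
  have hd₂ : HasDerivAt c₂ (u₂ 0) 0 := (hc₂ 0 ⟨le_rfl, hδ₀.le⟩).1
  obtain ⟨δ₁, hδ₁, hT₁⟩ := exists_taylor_bound hd₁ hκ0
  obtain ⟨δ₂, hδ₂, hT₂⟩ := exists_taylor_bound hd₂ hκ0
  -- Step 3: the scale `ε`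
  obtain ⟨nV, hnV⟩ : ∃ nV : ℝ, nV = ‖u₁ 0‖ + ‖u₂ 0‖ + κ + 1 := ⟨_, rfl⟩
  have hnV0 : 0 < nV := by rw [hnV]; positivity
  have hDt0 : 0 < 2 * ‖D‖ + 2 * δt + 1 := by positivity
  obtain ⟨ε, hε0, hεε₁, hεδ₀, hεδ₁, hεδ₂, hεr₁, hεr₂⟩ : ∃ ε : ℝ, 0 < ε ∧ ε ≤ ε₁ ∧ ε ≤ δ₀ ∧ ε < δ₁ ∧
      ε < δ₂ ∧ ε * (8 * nV) ≤ r₀ ∧ ε * (8 * (2 * ‖D‖ + 2 * δt + 1)) ≤ r₀ := by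
    refine ⟨min (min ε₁ δ₀) (min (min (δ₁ / 2) (δ₂ / 2))
      (min (r₀ / (8 * nV)) (r₀ / (8 * (2 * ‖D‖ + 2 * δt + 1))))), ?_, ?_, ?_, ?_, ?_, ?_, ?_⟩
    · simp only [lt_min_iff]
      exact ⟨⟨hε₁, hδ₀⟩, ⟨by positivity, by positivity⟩, by positivity, by positivity⟩
    · exact (min_le_left _ _).trans (min_le_left _ _)
    · exact (min_le_left _ _).trans (min_le_right _ _)
    · have : min (min ε₁ δ₀) (min (min (δ₁ / 2) (δ₂ / 2))
          (min (r₀ / (8 * nV)) (r₀ / (8 * (2 * ‖D‖ + 2 * δt + 1))))) ≤ δ₁ / 2 :=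
        (min_le_right _ _).trans ((min_le_left _ _).trans (min_le_left _ _))
      linarith
    · have : min (min ε₁ δ₀) (min (min (δ₁ / 2) (δ₂ / 2))
          (min (r₀ / (8 * nV)) (r₀ / (8 * (2 * ‖D‖ + 2 * δt + 1))))) ≤ δ₂ / 2 :=
        (min_le_right _ _).trans ((min_le_left _ _).trans (min_le_right _ _))
      linarith
    · have : min (min ε₁ δ₀) (min (min (δ₁ / 2) (δ₂ / 2))
          (min (r₀ / (8 * nV)) (r₀ / (8 * (2 * ‖D‖ + 2 * δt + 1))))) ≤ r₀ / (8 * nV) :=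
        (min_le_right _ _).trans ((min_le_right _ _).trans (min_le_left _ _))
      exact (le_div_iff₀ (by positivity)).mp this
    · have : min (min ε₁ δ₀) (min (min (δ₁ / 2) (δ₂ / 2))
          (min (r₀ / (8 * nV)) (r₀ / (8 * (2 * ‖D‖ + 2 * δt + 1))))) ≤
          r₀ / (8 * (2 * ‖D‖ + 2 * δt + 1)) :=
        (min_le_right _ _).trans ((min_le_right _ _).trans (min_le_right _ _))
      exact (le_div_iff₀ (by positivity)).mp this
  -- Step 4: the junction points `A = c₁(-ε)`, `B = c₂(ε)` and velocities there
  obtain ⟨hdA, hAR, ⟨hAww, hAw0⟩, hAfut⟩ := hc₁ (-ε) ⟨by linarith, by linarith⟩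
  obtain ⟨hdB, hBR, ⟨hBww, hBw0⟩, hBfut⟩ := hc₂ ε ⟨by linarith, hεδ₀⟩
  -- Taylor: `A ≈ x₀ - ε v̂₁`, `B ≈ x₀ + ε v̂₂`
  have hTA : ‖c₁ (-ε) - x₀ + ε • u₁ 0‖ ≤ κ * ε := by
    have := hT₁ (-ε) (by rw [sub_zero, abs_neg, abs_of_pos hε0]; exact hεδ₁)
    rw [h₁0, sub_zero, abs_neg, abs_of_pos hε0, neg_smul, sub_neg_eq_add] at this
    exact this
  have hTB : ‖c₂ ε - x₀ - ε • u₂ 0‖ ≤ κ * ε := by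
    have := hT₂ ε (by rw [sub_zero, abs_of_pos hε0]; exact hεδ₂)
    rw [h₂0, sub_zero, abs_of_pos hε0] at this
    exact this
  obtain ⟨A, hAdef⟩ : ∃ A : F, A = c₁ (-ε) := ⟨_, rfl⟩
  obtain ⟨w₁, hw₁def⟩ : ∃ w : F, w = u₁ (-ε) := ⟨_, rfl⟩
  obtain ⟨B, hBdef⟩ : ∃ B : F, B = c₂ ε := ⟨_, rfl⟩
  obtain ⟨w₂, hw₂def⟩ : ∃ w : F, w = u₂ ε := ⟨_, rfl⟩
  rw [← hAdef] at hAR hAww hAfut hTA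
  rw [← hw₁def] at hdA hAww hAw0 hAfut
  rw [← hBdef] at hBR hBww hBfut hTB
  rw [← hw₂def] at hdB hBww hBw0 hBfut
  have hκε : κ * ε + ε * ‖u₁ 0‖ + ε * ‖u₂ 0‖ ≤ r₀ / 8 := by
    have h1 : ε * nV = ε * ‖u₁ 0‖ + ε * ‖u₂ 0‖ + κ * ε + ε := by rw [hnV]; ring
    nlinarith only [hεr₁, h1, hε0]
  have hAx₀ : ‖A - x₀‖ ≤ r₀ / 8 := by
    have h1 : ‖A - x₀‖ ≤ ‖A - x₀ + ε • u₁ 0‖ + ‖ε • u₁ 0‖ := by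
      have := norm_sub_le (A - x₀ + ε • u₁ 0) (ε • u₁ 0); simpa using this
    have h2 : ‖ε • u₁ 0‖ = ε * ‖u₁ 0‖ := by rw [norm_smul, Real.norm_of_nonneg hε0.le]
    have h3 : 0 ≤ ε * ‖u₂ 0‖ := by positivity
    linarith only [h1, h2, h3, hTA, hκε]
  have hBx₀ : ‖B - x₀‖ ≤ r₀ / 8 := by
    have h1 : ‖B - x₀‖ ≤ ‖B - x₀ - ε • u₂ 0‖ + ‖ε • u₂ 0‖ := by
      have := norm_add_le (B - x₀ - ε • u₂ 0) (ε • u₂ 0); simpa using this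
    have h2 : ‖ε • u₂ 0‖ = ε * ‖u₂ 0‖ := by rw [norm_smul, Real.norm_of_nonneg hε0.le]
    have h3 : 0 ≤ ε * ‖u₁ 0‖ := by positivity
    linarith only [h1, h2, h3, hTB, hκε]
  have hAt : ‖A - x₀‖ < ρt := by linarith only [hAx₀, hr₀t, hr₀0]
  have hBt : ‖B - x₀‖ < ρt := by linarith only [hBx₀, hr₀t, hr₀0]
  obtain ⟨hAPP, hAPfut⟩ := hPtube A hAt
  obtain ⟨hBPP, hBPfut⟩ := hPtube B hBt
  have hAwP : G A w₁ P < 0 := hcone A hAR w₁ P hAww hAw0 hAfut hAPP hAPfut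
  have hBwP : G B w₂ P < 0 := hcone B hBR w₂ P hBww hBw0 hBfut hBPP hBPfut
  -- Step 5: the transition at `A`
  obtain ⟨L₁, hL₁, ρ₁, hρ₁, hLip₁⟩ := exists_bound_of_differentiableAt (hGd A hAR)
  have hcw₁ : ContinuousAt (fun x ↦ G x (T x) w₁) A := (hTc A hAR).clm_apply continuousAt_const
  obtain ⟨ρw₁, hρw₁, hTw₁⟩ : ∃ ρ : ℝ, 0 < ρ ∧ ∀ x, ‖x - A‖ < ρ → G x (T x) w₁ < 0 := by
    have := hcw₁.eventually (gt_mem_nhds hAfut)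
    rw [Metric.eventually_nhds_iff] at this
    obtain ⟨ρ, hρ, h⟩ := this
    exact ⟨ρ, hρ, fun x hx ↦ h (by rwa [dist_eq_norm])⟩
  obtain ⟨ρA, hρA0, hρA1, hρA2, hρA3⟩ : ∃ ρ : ℝ, 0 < ρ ∧ ρ ≤ ρ₁ ∧ ρ ≤ ρw₁ ∧ ρ ≤ ρt / 2 :=
    ⟨min ρ₁ (min ρw₁ (ρt / 2)), lt_min hρ₁ (lt_min hρw₁ (by positivity)), min_le_left _ _,
      (min_le_right _ _).trans (min_le_left _ _), (min_le_right _ _).trans (min_le_right _ _)⟩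
  have hballA : ∀ x, ‖x - A‖ < ρA → ‖x - x₀‖ < ρt := by
    intro x hx
    have h2 : ‖x - x₀‖ ≤ ‖x - A‖ + ‖A - x₀‖ := norm_sub_le_norm_sub_add_norm_sub _ _ _
    linarith only [hx, h2, hρA3, hAx₀, hr₀t, hρt]
  obtain ⟨η₀, hη₀, hestA⟩ := transCurve_estimate (G := G) (T := T) hL₁ hρA0
    (fun x hx ↦ hLip₁ x (hx.trans_le hρA1)) (fun x hx ↦ hTw₁ x (hx.trans_le hρA2))
    (fun x hx ↦ (hPtube x (hballA x hx)).2) (hsymm A hAR P w₁) hAww hAwP hAPP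
  -- Step 6: the transition at `B`, time-reversed
  obtain ⟨L₂, hL₂, ρ₂, hρ₂, hLip₂⟩ := exists_bound_of_differentiableAt (hGd B hBR)
  have hcw₂ : ContinuousAt (fun x ↦ G x (T x) w₂) B := (hTc B hBR).clm_apply continuousAt_const
  obtain ⟨ρw₂, hρw₂, hTw₂⟩ : ∃ ρ : ℝ, 0 < ρ ∧ ∀ x, ‖x - B‖ < ρ → G x (T x) w₂ < 0 := by
    have := hcw₂.eventually (gt_mem_nhds hBfut)
    rw [Metric.eventually_nhds_iff] at this
    obtain ⟨ρ, hρ, h⟩ := this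
    exact ⟨ρ, hρ, fun x hx ↦ h (by rwa [dist_eq_norm])⟩
  obtain ⟨ρB, hρB0, hρB1, hρB2, hρB3⟩ : ∃ ρ : ℝ, 0 < ρ ∧ ρ ≤ ρ₂ ∧ ρ ≤ ρw₂ ∧ ρ ≤ ρt / 2 :=
    ⟨min ρ₂ (min ρw₂ (ρt / 2)), lt_min hρ₂ (lt_min hρw₂ (by positivity)), min_le_left _ _,
      (min_le_right _ _).trans (min_le_left _ _), (min_le_right _ _).trans (min_le_right _ _)⟩
  have hballB : ∀ x, ‖x - B‖ < ρB → ‖x - x₀‖ < ρt := by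
    intro x hx
    have h2 : ‖x - x₀‖ ≤ ‖x - B‖ + ‖B - x₀‖ := norm_sub_le_norm_sub_add_norm_sub _ _ _
    linarith only [hx, h2, hρB3, hBx₀, hr₀t, hρt]
  obtain ⟨η₀', hη₀', hestB⟩ := transCurve_estimate (G := G) (T := fun x ↦ -T x)
    (A := B) (w := -w₂) (P := -P) hL₂ hρB0
    (fun x hx ↦ hLip₂ x (hx.trans_le hρB1))
    (fun x hx ↦ by simpa using hTw₂ x (hx.trans_le hρB2))
    (fun x hx ↦ by simpa using (hPtube x (hballB x hx)).2)
    (by simpa using hsymm B hBR P w₂) (by simpa using hBww) (by simpa using hBwP)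
    (by simpa using hBPP)
  -- Step 7: the transition lengths `η, η'`
  have hκε0 : 0 < κ * ε := mul_pos hκ0 hε0
  obtain ⟨η, hη0, hηη₀, hη2, hη3⟩ : ∃ η : ℝ, 0 < η ∧ η ≤ η₀ ∧ 2 * η * (‖w₁‖ + ‖P‖) ≤ r₀ / 8 ∧
      η / 2 * ‖w₁ + P‖ ≤ κ * ε := by
    refine ⟨min η₀ (min (r₀ / (16 * (‖w₁‖ + ‖P‖) + 1)) (κ * ε / (‖w₁ + P‖ + 1))),
      lt_min hη₀ (lt_min (by positivity) (by positivity)), min_le_left _ _, ?_, ?_⟩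
    · have h : min η₀ (min (r₀ / (16 * (‖w₁‖ + ‖P‖) + 1)) (κ * ε / (‖w₁ + P‖ + 1))) ≤
          r₀ / (16 * (‖w₁‖ + ‖P‖) + 1) := (min_le_right _ _).trans (min_le_left _ _)
      have h' := (le_div_iff₀ (by positivity : (0:ℝ) < 16 * (‖w₁‖ + ‖P‖) + 1)).mp h
      have h0 : 0 ≤ min η₀ (min (r₀ / (16 * (‖w₁‖ + ‖P‖) + 1)) (κ * ε / (‖w₁ + P‖ + 1))) :=
        (lt_min hη₀ (lt_min (by positivity) (by positivity))).le
      have hw : 0 ≤ ‖w₁‖ + ‖P‖ := by positivity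
      nlinarith only [h', h0, hw, hr₀0]
    · have h : min η₀ (min (r₀ / (16 * (‖w₁‖ + ‖P‖) + 1)) (κ * ε / (‖w₁ + P‖ + 1))) ≤
          κ * ε / (‖w₁ + P‖ + 1) := (min_le_right _ _).trans (min_le_right _ _)
      have h' := (le_div_iff₀ (by positivity : (0:ℝ) < ‖w₁ + P‖ + 1)).mp h
      have h0 : 0 ≤ min η₀ (min (r₀ / (16 * (‖w₁‖ + ‖P‖) + 1)) (κ * ε / (‖w₁ + P‖ + 1))) :=
        (lt_min hη₀ (lt_min (by positivity) (by positivity))).le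
      have hw : 0 ≤ ‖w₁ + P‖ := norm_nonneg _
      nlinarith only [h', h0, hw, hκε0]
  obtain ⟨η', hη'0, hη'η₀, hη'2, hη'3⟩ : ∃ η' : ℝ, 0 < η' ∧ η' ≤ η₀' ∧
      2 * η' * (‖w₂‖ + ‖P‖) ≤ r₀ / 8 ∧ η' / 2 * ‖w₂ + P‖ ≤ κ * ε := by
    refine ⟨min η₀' (min (r₀ / (16 * (‖w₂‖ + ‖P‖) + 1)) (κ * ε / (‖w₂ + P‖ + 1))),
      lt_min hη₀' (lt_min (by positivity) (by positivity)), min_le_left _ _, ?_, ?_⟩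
    · have h : min η₀' (min (r₀ / (16 * (‖w₂‖ + ‖P‖) + 1)) (κ * ε / (‖w₂ + P‖ + 1))) ≤
          r₀ / (16 * (‖w₂‖ + ‖P‖) + 1) := (min_le_right _ _).trans (min_le_left _ _)
      have h' := (le_div_iff₀ (by positivity : (0:ℝ) < 16 * (‖w₂‖ + ‖P‖) + 1)).mp h
      have h0 : 0 ≤ min η₀' (min (r₀ / (16 * (‖w₂‖ + ‖P‖) + 1)) (κ * ε / (‖w₂ + P‖ + 1))) :=
        (lt_min hη₀' (lt_min (by positivity) (by positivity))).le
      have hw : 0 ≤ ‖w₂‖ + ‖P‖ := by positivity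
      nlinarith only [h', h0, hw, hr₀0]
    · have h : min η₀' (min (r₀ / (16 * (‖w₂‖ + ‖P‖) + 1)) (κ * ε / (‖w₂ + P‖ + 1))) ≤
          κ * ε / (‖w₂ + P‖ + 1) := (min_le_right _ _).trans (min_le_right _ _)
      have h' := (le_div_iff₀ (by positivity : (0:ℝ) < ‖w₂ + P‖ + 1)).mp h
      have h0 : 0 ≤ min η₀' (min (r₀ / (16 * (‖w₂‖ + ‖P‖) + 1)) (κ * ε / (‖w₂ + P‖ + 1))) :=
        (lt_min hη₀' (lt_min (by positivity) (by positivity))).le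
      have hw : 0 ≤ ‖w₂ + P‖ := norm_nonneg _
      nlinarith only [h', h0, hw, hκε0]
  -- Step 8: the parameters of the pieces and the bridge data
  obtain ⟨s₂, hs₂⟩ : ∃ s : ℝ, s = -ε + η := ⟨_, rfl⟩
  obtain ⟨s₃, hs₃⟩ : ∃ s : ℝ, s = s₂ + ε := ⟨_, rfl⟩
  obtain ⟨s₄, hs₄⟩ : ∃ s : ℝ, s = s₃ + η' := ⟨_, rfl⟩
  obtain ⟨A', hA'⟩ : ∃ A' : F, A' = A + (η / 2) • (w₁ + P) := ⟨_, rfl⟩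
  obtain ⟨B', hB'⟩ : ∃ B' : F, B' = B + (η' / 2) • (-w₂ + -P) := ⟨_, rfl⟩
  obtain ⟨Dt, hDt⟩ : ∃ Dt : F, Dt = (3 / (2 * ε)) • (B' - A') - (1 / 2 : ℝ) • P := ⟨_, rfl⟩
  -- the error of `Dt` relative to `(5/4) D`
  have herr : ‖Dt - (5 / 4 : ℝ) • D‖ ≤ δt := by
    have hZ : B' - A' = ε • D + ((B - x₀ - ε • u₂ 0) - (A - x₀ + ε • u₁ 0)
        + (η' / 2) • (-w₂ + -P) - (η / 2) • (w₁ + P)) := by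
      rw [hA', hB', hDdef]; simp only [smul_add]; abel
    have hexp : Dt - (5 / 4 : ℝ) • D = (3 / (2 * ε)) • ((B - x₀ - ε • u₂ 0) - (A - x₀ + ε • u₁ 0)
        + (η' / 2) • (-w₂ + -P) - (η / 2) • (w₁ + P)) := by
      rw [hDt, hZ, hPdef]
      simp only [smul_add, smul_sub, smul_smul]
      have h1 : 3 / (2 * ε) * ε = 3 / 2 := by field_simp
      rw [h1]
      module
    rw [hexp, norm_smul, Real.norm_of_nonneg (by positivity)]
    have hn1 : ‖(η' / 2) • (-w₂ + -P)‖ ≤ κ * ε := by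
      rw [norm_smul, Real.norm_of_nonneg (by positivity), show -w₂ + -P = -(w₂ + P) by abel,
        norm_neg]; exact hη'3
    have hn2 : ‖(η / 2) • (w₁ + P)‖ ≤ κ * ε := by
      rw [norm_smul, Real.norm_of_nonneg (by positivity)]; exact hη3
    have hZn : ‖(B - x₀ - ε • u₂ 0) - (A - x₀ + ε • u₁ 0) + (η' / 2) • (-w₂ + -P)
        - (η / 2) • (w₁ + P)‖ ≤ 4 * (κ * ε) := by
      refine (norm_sub_le _ _).trans ?_
      refine (add_le_add (norm_add_le _ _) le_rfl).trans ?_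
      refine (add_le_add (add_le_add (norm_sub_le _ _) le_rfl) le_rfl).trans ?_
      linarith only [hTA, hTB, hn1, hn2]
    calc 3 / (2 * ε) * ‖(B - x₀ - ε • u₂ 0) - (A - x₀ + ε • u₁ 0) + (η' / 2) • (-w₂ + -P)
          - (η / 2) • (w₁ + P)‖ ≤ 3 / (2 * ε) * (4 * (κ * ε)) := by gcongr
      _ = 6 * κ := by field_simp; ring
      _ = δt := by rw [hκ]; ring
  -- bridge velocities lie in the tube
  have hbridge_vel : ∀ b ∈ Icc (0 : ℝ) 1, ∃ μ ∈ Icc (1 / 2 : ℝ) 2, ∃ e : F, ‖e‖ ≤ δt ∧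
      (1 - b) • P + b • Dt = μ • D + e := by
    intro b hb
    refine ⟨1 / 2 + 3 / 4 * b, ⟨by linarith [hb.1], by linarith [hb.2]⟩,
      b • (Dt - (5 / 4 : ℝ) • D), ?_, ?_⟩
    · rw [norm_smul, Real.norm_of_nonneg hb.1]
      calc b * ‖Dt - (5 / 4 : ℝ) • D‖ ≤ 1 * δt := by gcongr; exact hb.2
        _ = δt := one_mul _
    · rw [hPdef]; module
  have hPn : ‖P‖ = 1 / 2 * ‖D‖ := by rw [hPdef, norm_smul, Real.norm_of_nonneg (by norm_num)]
  have hDtP : ‖Dt - P‖ ≤ 3 / 4 * ‖D‖ + δt := by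
    have h1 : Dt - P = (3 / 4 : ℝ) • D + (Dt - (5 / 4 : ℝ) • D) := by rw [hPdef]; module
    rw [h1]
    refine (norm_add_le _ _).trans ?_
    rw [norm_smul, Real.norm_of_nonneg (by norm_num)]
    linarith only [herr]
  -- Step 9: the pieces (`Q` = the property to be propagated)
  set Q : F → F → Prop := fun x v ↦ ‖x - x₀‖ < R ∧ (G x v v ≤ 0 ∧ v ≠ 0) ∧ G x (T x) v < 0
    with hQ
  set xa : ℝ → F := fun s ↦ transCurve A w₁ P η (s + ε) with hxa
  set ua : ℝ → F := fun s ↦ transVel w₁ P η (s + ε) with hua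
  set xc : ℝ → F := fun s ↦ bridgeCurve A' P Dt ε (s - s₂) with hxc
  set uc : ℝ → F := fun s ↦ bridgeVel P Dt ε (s - s₂) with huc
  set xb : ℝ → F := fun s ↦ transCurve B (-w₂) (-P) η' (s₄ - s) with hxb
  set ub : ℝ → F := fun s ↦ -transVel (-w₂) (-P) η' (s₄ - s) with hub
  set c₂' : ℝ → F := fun s ↦ c₂ (s + (ε - s₄)) with hc₂'
  set u₂' : ℝ → F := fun s ↦ u₂ (s + (ε - s₄)) with hu₂'
  -- goodness of the transition at `A`
  have ga : ∀ s ∈ Icc (-ε) s₂, HasDerivAt xa (ua s) s ∧ Q (xa s) (ua s) := by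
    intro s hs
    have hs' : s + ε ∈ Icc (0 : ℝ) η :=
      ⟨by linarith only [hs.1], by rw [hs₂] at hs; linarith only [hs.2]⟩
    obtain ⟨hball, hle, -, hne, hfut⟩ := hestA η hη0 hηη₀ (s + ε) hs'
    refine ⟨(hasDerivAt_transCurve A w₁ P η (s + ε)).comp_add_const s ε, ?_, ⟨hle, hne⟩, hfut⟩
    have h1 := norm_transCurve_sub_le A w₁ P hη0 hs'.1 hs'.2
    have h2 : ‖transCurve A w₁ P η (s + ε) - x₀‖ ≤
        ‖transCurve A w₁ P η (s + ε) - A‖ + ‖A - x₀‖ := norm_sub_le_norm_sub_add_norm_sub _ _ _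
    have h3 : 2 * (s + ε) * (‖w₁‖ + ‖P‖) ≤ 2 * η * (‖w₁‖ + ‖P‖) := by gcongr; exact hs'.2
    show ‖transCurve A w₁ P η (s + ε) - x₀‖ < R
    linarith only [h1, h2, h3, hη2, hAx₀, hr₀R, hr₀0]
  -- goodness of the bridge
  have hA'A : ‖A' - A‖ ≤ κ * ε := by
    rw [hA', add_sub_cancel_left, norm_smul, Real.norm_of_nonneg (by positivity)]; exact hη3
  have gc : ∀ s ∈ Icc s₂ s₃, HasDerivAt xc (uc s) s ∧ Q (xc s) (uc s) := by
    intro s hs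
    have hs0 : 0 ≤ s - s₂ := by linarith only [hs.1]
    have hs1 : s - s₂ ≤ ε := by rw [hs₃] at hs; linarith only [hs.2]
    refine ⟨(hasDerivAt_bridgeCurve A' P Dt ε (s - s₂)).comp_sub_const s s₂, ?_⟩
    -- position
    have hpos : ‖bridgeCurve A' P Dt ε (s - s₂) - x₀‖ < r₀ := by
      have h1 := norm_bridgeCurve_sub_le A' P Dt hε0 hs0 hs1
      have h2 : ‖bridgeCurve A' P Dt ε (s - s₂) - x₀‖ ≤ ‖bridgeCurve A' P Dt ε (s - s₂) - A'‖
          + (‖A' - A‖ + ‖A - x₀‖) :=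
        (norm_sub_le_norm_sub_add_norm_sub _ A' _).trans
          (add_le_add le_rfl (norm_sub_le_norm_sub_add_norm_sub A' A x₀))
      have h3 : (s - s₂) * (‖P‖ + 2 * ‖Dt - P‖) ≤ ε * (2 * ‖D‖ + 2 * δt) := by
        have : ‖P‖ + 2 * ‖Dt - P‖ ≤ 2 * ‖D‖ + 2 * δt := by rw [hPn]; linarith only [hDtP]
        calc (s - s₂) * (‖P‖ + 2 * ‖Dt - P‖) ≤ ε * (‖P‖ + 2 * ‖Dt - P‖) := by gcongr
          _ ≤ ε * (2 * ‖D‖ + 2 * δt) := by gcongr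
      have h4 : ε * (2 * ‖D‖ + 2 * δt) ≤ r₀ / 8 := by nlinarith only [hεr₂, hε0]
      have h5 : κ * ε ≤ r₀ / 8 := by
        have : 0 ≤ ε * ‖u₁ 0‖ + ε * ‖u₂ 0‖ := by positivity
        linarith only [hκε, this]
      linarith only [h1, h2, h3, h4, h5, hA'A, hAx₀, hr₀0]
    refine ⟨hpos.trans_le hr₀R, ?_⟩
    -- velocity
    have hb := bridge_coeff_mem hε0 hs0 hs1
    obtain ⟨μ, hμ, e, he, hveq⟩ := hbridge_vel _ hb
    have hvel : bridgeVel P Dt ε (s - s₂) = μ • D + e := by rw [bridgeVel_eq, hveq]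
    obtain ⟨ht1, ht2⟩ := htube _ (hpos.trans_le hr₀t) μ hμ e he
    show (G (bridgeCurve A' P Dt ε (s - s₂)) (bridgeVel P Dt ε (s - s₂))
        (bridgeVel P Dt ε (s - s₂)) ≤ 0 ∧ bridgeVel P Dt ε (s - s₂) ≠ 0) ∧
      G (bridgeCurve A' P Dt ε (s - s₂)) (T (bridgeCurve A' P Dt ε (s - s₂)))
        (bridgeVel P Dt ε (s - s₂)) < 0
    rw [hvel]
    refine ⟨⟨ht1.le, fun h0 ↦ ?_⟩, ht2⟩
    rw [h0, map_zero] at ht2; exact lt_irrefl 0 ht2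
  -- goodness of the reversed transition at `B`
  have gb : ∀ s ∈ Icc s₃ s₄, HasDerivAt xb (ub s) s ∧ Q (xb s) (ub s) := by
    have hraw : ∀ s ∈ Icc (0 : ℝ) η', HasDerivAt (transCurve B (-w₂) (-P) η')
        (transVel (-w₂) (-P) η' s) s ∧ ‖transCurve B (-w₂) (-P) η' s - x₀‖ < R ∧
        (G (transCurve B (-w₂) (-P) η' s) (transVel (-w₂) (-P) η' s) (transVel (-w₂) (-P) η' s) ≤ 0
          ∧ transVel (-w₂) (-P) η' s ≠ 0) ∧
        G (transCurve B (-w₂) (-P) η' s) (-T (transCurve B (-w₂) (-P) η' s))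
          (transVel (-w₂) (-P) η' s) < 0 := by
      intro s hs
      obtain ⟨hball, hle, -, hne, hfut⟩ := hestB η' hη'0 hη'η₀ s hs
      refine ⟨hasDerivAt_transCurve _ _ _ _ _, ?_, ⟨hle, hne⟩, hfut⟩
      have h1 := norm_transCurve_sub_le B (-w₂) (-P) hη'0 hs.1 hs.2
      rw [norm_neg, norm_neg] at h1
      have h2 : ‖transCurve B (-w₂) (-P) η' s - x₀‖ ≤
          ‖transCurve B (-w₂) (-P) η' s - B‖ + ‖B - x₀‖ := norm_sub_le_norm_sub_add_norm_sub _ _ _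
      have h3 : 2 * s * (‖w₂‖ + ‖P‖) ≤ 2 * η' * (‖w₂‖ + ‖P‖) := by gcongr; exact hs.2
      linarith only [h1, h2, h3, hη'2, hBx₀, hr₀R, hr₀0]
    have := rev_good (s₄ := s₄) hraw
    have hs₃' : s₄ - η' = s₃ := by rw [hs₄]; ring
    rw [hs₃'] at this
    exact this
  -- goodness of the shifted `c₂` at `s₄`
  have g₂ : ∀ s ∈ Icc s₄ s₄, HasDerivAt c₂' (u₂' s) s ∧ Q (c₂' s) (u₂' s) := by
    intro s hs
    have hs' : s = s₄ := le_antisymm hs.2 hs.1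
    subst hs'
    obtain ⟨hd, hq⟩ := hc₂ ε ⟨hε0.le, hεδ₀⟩
    have hεeq : s + (ε - s) = ε := by ring
    refine ⟨?_, ?_⟩
    · have hd' : HasDerivAt c₂ (u₂ (s + (ε - s))) (s + (ε - s)) := by rw [hεeq]; exact hd
      exact hd'.comp_add_const s (ε - s)
    · show Q (c₂ (s + (ε - s))) (u₂ (s + (ε - s)))
      rw [hεeq]; exact hq
  -- goodness of `c₁` at `-ε`
  have g₁ : ∀ s ∈ Icc (-ε) (-ε), HasDerivAt c₁ (u₁ s) s ∧ Q (c₁ s) (u₁ s) :=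
    fun s hs ↦ hc₁ s ⟨by linarith only [hs.1, hεδ₀], by linarith only [hs.2, hε0]⟩
  -- Step 10: junction identities
  have hηne : η ≠ 0 := hη0.ne'
  have hη'ne : η' ≠ 0 := hη'0.ne'
  have hεne : ε ≠ 0 := hε0.ne'
  have h23 : s₂ ≤ s₃ := by rw [hs₃]; linarith only [hε0]
  have h34 : s₃ ≤ s₄ := by rw [hs₄]; linarith only [hη'0]
  have h12 : -ε ≤ s₂ := by rw [hs₂]; linarith only [hη0]
  have j₁ : c₁ (-ε) = xa (-ε) := by simp [hxa, hAdef]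
  have j₁' : u₁ (-ε) = ua (-ε) := by simp [hua, hw₁def]
  have j₂ : xa s₂ = xc s₂ := by
    simp only [hxa, hxc, sub_self, bridgeCurve_zero]
    rw [hs₂, show -ε + η + ε = η by ring, transCurve_self A w₁ P hηne, hA']
  have j₂' : ua s₂ = uc s₂ := by
    simp only [hua, huc, sub_self, bridgeVel_zero]
    rw [hs₂, show -ε + η + ε = η by ring, transVel_self w₁ P hηne]
  have j₃ : xc s₃ = xb s₃ := by
    simp only [hxc, hxb]
    rw [show s₃ - s₂ = ε by rw [hs₃]; ring, show s₄ - s₃ = η' by rw [hs₄]; ring, hDt,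
      bridgeCurve_self_eq A' B' P hεne, transCurve_self B (-w₂) (-P) hη'ne, hB']
  have j₃' : uc s₃ = ub s₃ := by
    simp only [huc, hub]
    rw [show s₃ - s₂ = ε by rw [hs₃]; ring, show s₄ - s₃ = η' by rw [hs₄]; ring,
      bridgeVel_self P Dt hεne, transVel_self (-w₂) (-P) hη'ne, neg_neg]
  have j₄ : xb s₄ = c₂' s₄ := by
    simp only [hxb, hc₂', sub_self, transCurve_zero]
    rw [show s₄ + (ε - s₄) = ε by ring, hBdef]
  have j₄' : ub s₄ = u₂' s₄ := by
    simp only [hub, hu₂', sub_self, transVel_zero, neg_neg]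
    rw [show s₄ + (ε - s₄) = ε by ring, hw₂def]
  -- Step 11: glue
  have g34 := good_glueAt gb g₂ j₄ j₄'
  have g234 := good_glueAt gc g34 (j₃.trans (glueAt_of_le h34).symm)
    (j₃'.trans (glueAt_of_le h34).symm)
  have g1234 := good_glueAt ga g234 (j₂.trans (glueAt_of_le h23).symm)
    (j₂'.trans (glueAt_of_le h23).symm)
  have gall := good_glueAt g₁ g1234 (j₁.trans (glueAt_of_le h12).symm)
    (j₁'.trans (glueAt_of_le h12).symm)
  have hs₄ε : -ε < s₄ := by rw [hs₄, hs₃, hs₂]; linarith only [hη0, hη'0, hε0]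
  refine ⟨ε, s₄, hε0, hεε₁, hεδ₀, hs₄ε, _, _, gall, fun s hs ↦ glueAt_of_le hs, fun s hs ↦ ?_⟩
  rcases eq_or_lt_of_le hs with heq | hlt
  · subst heq
    have h2 : s₂ < s₄ := by rw [hs₄, hs₃]; linarith only [hη'0, hε0]
    have h3 : s₃ < s₄ := by rw [hs₄]; linarith only [hη'0]
    rw [glueAt_of_lt hs₄ε, glueAt_of_lt h2, glueAt_of_lt h3, glueAt_of_le le_rfl, j₄]
    show c₂ (s₄ + (ε - s₄)) = c₂ (s₄ - s₄ + ε)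
    congr 1; ring
  · have h1 : -ε < s := hs₄ε.trans hlt
    have h2 : s₂ < s := by rw [hs₄, hs₃] at hlt; linarith only [hlt, hη'0, hε0]
    have h3 : s₃ < s := by rw [hs₄] at hlt; linarith only [hlt, hη'0]
    rw [glueAt_of_lt h1, glueAt_of_lt h2, glueAt_of_lt h3, glueAt_of_lt hlt]
    show c₂ (s + (ε - s₄)) = c₂ (s - s₄ + ε)
    congr 1; ring


end CausalCurveGluing

end Literature.Geometry.Lorentzian

end
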